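import Summits.ResolutionOfSingularities.ResolutionOfSingularities.Theorems.WeightedInvariantFormallySmoothResiduePolynomial
import HarnessLib

/-!
# (c11)≤3 for the flat centre filtration `J₃ᵗ = Iota3.jFlatT`, PART 6b-ii/3 — DEHOMOGENISATION of the level-`b` face
# in dimension three, and rationality of the degree-`b` correction (door `HypersurfaceCentreConstruction`,
# stmt-ResolutionOfSingularities-19897; P3 rung clause (c11)≤3; ORDER (o53) PART 6 = GAP 1′, hand res-L1-w43-stub-3)

Topic: `Summits/ResolutionOfSingularities/ResolutionOfSingularities/Theorems`. Helper for the door item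
`HypersurfaceCentreConstruction` (stmt-ResolutionOfSingularities-19897, route `WeightedInvariant`), line `local-engine`
(L W4.3), def-free.  In dimension three the descent of one contact level along an essentially smooth local map
`φ : S → S'` (GAP 1″ = `hcorr` of PART 6a `JFlatEssSmooth.bMax_map_eq_of_corrections`, p547358) ends in an identity of
initial forms in `κ(S')[Y, U₁, U₂]`

  `in(f) ⊗ κ(S') = a · (Y + R)^ν`,   `R ∈ κ(S')[U₁, U₂]` a binary FORM of degree `d` (`d = b` the level, or `d = 1`),

and one must conclude that `R` is defined over `κ(S)`.  THIS FILE does the polynomial algebra: the substitution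
`θ : Y ↦ T, U₁ ↦ X, U₂ ↦ 1` into `K[X][T]` turns the identity into the binomial row
`A_j ⊗ K = a · C(ν, j) · η(R)^{ν-j}` (`η : Y ↦ 0, U₁ ↦ X, U₂ ↦ 1` the dehomogenisation, `A_j ∈ κ[X]` the `T^j`-coefficient
of `θ(in f)`), PART 6b-i's (F4) `FormallySmoothField.exists_map_eq_of_binomial_face_polynomial` (p548127) makes `η(R)`
rational, and a face form is recovered from its dehomogenisation.

* §1 face forms (`supp R ⊆ {Y-free monomials of U-degree d}`): `finsupp_eq_single_add_single`, `aeval_dehom_monomial`,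
  **`coeff_aeval_dehom_of_face`** (`η(R)_i = R_{(0,i,d-i)}`), **`eq_sum_monomial_of_face`** (`R = Σ_i η(R)_i U₁^i U₂^{d-i}`).
* §2 the substitution `θ`: `aeval_theta_eq_C_of_face` (`θ(R) = C(η R)` for `Y`-free `R`), `aeval_theta_map` (naturality in
  the coefficient field).
* §3 **`exists_eq_map_of_face_identity`** — `K / κ` formally smooth and essentially of finite type, `ν ≥ 1`, `a ≠ 0`, `R` a
  face form of degree `d`, `in ⊗ K = a (Y + R)^ν` ⇒ `R = (Σ_i (R₀)_i U₁^i U₂^{d-i}) ⊗ K` for some `R₀ ∈ κ[X]`.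

[OURS · L1 W4.3 · (o53)]  Replaces the role of NO printed item; NOT a statement of the manuscript
[claim: Hironaka2017, status: under-review]. AI work, weaker than expert review.  Pure polynomial algebra; no named facts.

## References

* H. Hironaka, *Characteristic polyhedra of singularities*, J. Math. Kyoto Univ. 7 (1967), §3 (solvable vertices). [Hironaka1967]
* V. Cossart, U. Jannsen, S. Saito, LNM 2270 (2020), §8. [CossartJannsenSaito2020]
-/

noncomputable section

open MvPolynomial

set_option linter.dupNamespace false -- mandated namespace of this single-conjunct summit

namespace Summit.ResolutionOfSingularities.ResolutionOfSingularities.Theorems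

namespace JFlatEssSmooth

/-! ## §1 Face forms and their dehomogenisation `η : Y ↦ 0, U₁ ↦ X, U₂ ↦ 1` -/

section Face

variable {K : Type} [CommRing K]

/-- A `Y`-free exponent of `U`-degree `d` is determined by its `U₁`-exponent. [folklore] -/
theorem finsupp_eq_single_add_single {d : ℕ} {m : Fin 3 →₀ ℕ} (h0 : m 0 = 0) (hd : m 1 + m 2 = d) :
    m = Finsupp.single 1 (m 1) + Finsupp.single 2 (d - m 1) := by
  ext i
  fin_cases i
  · simpa [Finsupp.single_apply] using h0
  · simp
  · simp
    omega

/-- `η(a · Y^0 U₁^i U₂^j) = a X^i`. [folklore] -/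
theorem aeval_dehom_monomial (m : Fin 3 →₀ ℕ) (h0 : m 0 = 0) (a : K) :
    MvPolynomial.aeval (![0, Polynomial.X, 1] : Fin 3 → Polynomial K) (monomial m a) =
      Polynomial.C a * Polynomial.X ^ (m 1) := by
  simp [MvPolynomial.aeval_monomial, Finsupp.prod_pow, Fin.prod_univ_three, Polynomial.algebraMap_eq, h0]

/-- **The coefficients of the dehomogenisation of a face form**: if every monomial of `R` is `Y`-free of `U`-degree `d`,
then `η(R)_i = R_{(0, i, d - i)}` for every `i`. [folklore] -/
theorem coeff_aeval_dehom_of_face {d : ℕ} {R : MvPolynomial (Fin 3) K}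
    (hR : ∀ m ∈ R.support, m 0 = 0 ∧ m 1 + m 2 = d) (i : ℕ) :
    (MvPolynomial.aeval (![0, Polynomial.X, 1] : Fin 3 → Polynomial K) R).coeff i =
      R.coeff (Finsupp.single 1 i + Finsupp.single 2 (d - i)) := by
  classical
  conv_lhs => rw [R.as_sum]
  rw [map_sum, Polynomial.finsetSum_coeff]
  have hterm : ∀ m ∈ R.support, ((MvPolynomial.aeval (![0, Polynomial.X, 1] : Fin 3 → Polynomial K))
      (monomial m (R.coeff m))).coeff i = if i = m 1 then R.coeff m else 0 := by
    intro m hm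
    rw [aeval_dehom_monomial m (hR m hm).1, Polynomial.coeff_C_mul_X_pow]
  rw [Finset.sum_congr rfl hterm, Finset.sum_eq_single (Finsupp.single 1 i + Finsupp.single 2 (d - i))]
  · simp
  · intro m hm hne
    rw [if_neg]
    intro hi
    apply hne
    obtain ⟨h0, hd⟩ := hR m hm
    rw [finsupp_eq_single_add_single h0 hd, ← hi]
  · intro hm₀
    rw [MvPolynomial.notMem_support_iff] at hm₀
    rw [hm₀, ite_self]

/-- **A face form is the homogenisation of its dehomogenisation**: `R = Σ_{i ≤ d} η(R)_i · U₁^i U₂^{d-i}`. [folklore] -/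
theorem eq_sum_monomial_of_face {d : ℕ} {R : MvPolynomial (Fin 3) K}
    (hR : ∀ m ∈ R.support, m 0 = 0 ∧ m 1 + m 2 = d) :
    R = ∑ i ∈ Finset.range (d + 1), monomial (Finsupp.single 1 i + Finsupp.single 2 (d - i))
      ((MvPolynomial.aeval (![0, Polynomial.X, 1] : Fin 3 → Polynomial K) R).coeff i) := by
  classical
  ext m
  rw [coeff_sum]
  simp only [coeff_monomial]
  by_cases hm : m 0 = 0 ∧ m 1 + m 2 = d
  · obtain ⟨h0, hd⟩ := hm
    rw [Finset.sum_eq_single (m 1)]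
    · rw [if_pos (finsupp_eq_single_add_single h0 hd).symm, coeff_aeval_dehom_of_face hR,
        ← finsupp_eq_single_add_single h0 hd]
    · intro i _ hi
      rw [if_neg]
      intro h
      apply hi
      have h1 := congrArg (fun e : Fin 3 →₀ ℕ => e 1) h
      simpa [Finsupp.single_apply] using h1
    · intro hi
      exfalso
      apply hi
      rw [Finset.mem_range]
      omega
  · have hcoeff : R.coeff m = 0 := by
      by_contra h
      exact hm (hR m (mem_support_iff.mpr h))
    rw [hcoeff, eq_comm]
    refine Finset.sum_eq_zero fun i hi => ?_
    rw [if_neg]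
    rintro rfl
    apply hm
    have hi' := Finset.mem_range.mp hi
    refine ⟨by simp, ?_⟩
    simp
    omega

end Face

/-! ## §2 The substitution `θ : Y ↦ T, U₁ ↦ X, U₂ ↦ 1` into `K[X][T]` -/

section Theta

variable {K : Type} [CommRing K]

/-- **`θ(R) = C(η R)` for a `Y`-free `R`** (no `T` appears). [folklore] -/
theorem aeval_theta_eq_C_of_face {R : MvPolynomial (Fin 3) K} (hR : ∀ m ∈ R.support, m 0 = 0) :
    MvPolynomial.aeval (![Polynomial.X, Polynomial.C Polynomial.X, 1] : Fin 3 → Polynomial (Polynomial K)) R =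
      Polynomial.C (MvPolynomial.aeval (![0, Polynomial.X, 1] : Fin 3 → Polynomial K) R) := by
  conv_lhs => rw [R.as_sum]
  conv_rhs => rw [R.as_sum]
  rw [map_sum, map_sum, map_sum]
  refine Finset.sum_congr rfl fun m hm => ?_
  rw [aeval_dehom_monomial m (hR m hm)]
  simp [MvPolynomial.aeval_monomial, Finsupp.prod_pow, Fin.prod_univ_three, Polynomial.algebraMap_apply, hR m hm]

/-- **Naturality of `θ` in the coefficients**: `θ(P ⊗ K) = θ(P) ⊗ K`. [folklore] -/
theorem aeval_theta_map {κ : Type} [CommRing κ] (ι : κ →+* K) (P : MvPolynomial (Fin 3) κ) :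
    MvPolynomial.aeval (![Polynomial.X, Polynomial.C Polynomial.X, 1] : Fin 3 → Polynomial (Polynomial K))
        (MvPolynomial.map ι P) =
      Polynomial.map (Polynomial.mapRingHom ι)
        (MvPolynomial.aeval (![Polynomial.X, Polynomial.C Polynomial.X, 1] : Fin 3 → Polynomial (Polynomial κ)) P) := by
  have key : (MvPolynomial.aeval
        (![Polynomial.X, Polynomial.C Polynomial.X, 1] : Fin 3 → Polynomial (Polynomial K))).toRingHom.comp
        (MvPolynomial.map ι) =
      (Polynomial.mapRingHom (Polynomial.mapRingHom ι)).comp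
        (MvPolynomial.aeval
          (![Polynomial.X, Polynomial.C Polynomial.X, 1] : Fin 3 → Polynomial (Polynomial κ))).toRingHom := by
    refine MvPolynomial.ringHom_ext (fun a => ?_) (fun i => ?_)
    · simp [Polynomial.algebraMap_apply]
    · fin_cases i <;> simp
  have h := RingHom.congr_fun key P
  simpa using h

end Theta

/-! ## §3 Rationality of the face root -/

/-- **RATIONALITY OF THE DEGREE-`d` CORRECTION.**  `K / κ` a formally smooth, essentially-of-finite-type field extension,
`ν ≥ 1`, `a ∈ K` nonzero, `R ∈ K[Y, U₁, U₂]` a `Y`-free form of `U`-degree `d`, and `P ∈ κ[Y, U₁, U₂]` with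
`P ⊗ K = a · (Y + R)^ν`.  Then `R = (Σ_{i ≤ d} (R₀)_i U₁^i U₂^{d-i}) ⊗ K` for some `R₀ ∈ κ[X]`: apply `θ`, read the binomial
row `(θ P)_j ⊗ K = a · C(ν, j) · η(R)^{ν-j}` (`Polynomial.coeff_X_add_C_pow`), PART 6b-i's (F4), and §1.  This is the
«solvable vertex is rational» step of the descent of contact levels in dimension three (`d = b ≥ 2`: the level-`b` face;
`d = 1`: the tangent direction of a better contact parameter). [cite: Hironaka1967, §3] -/
theorem exists_eq_map_of_face_identity (κ K : Type) [Field κ] [Field K] [Algebra κ K] [Algebra.FormallySmooth κ K]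
    [Algebra.EssFiniteType κ K] {ν d : ℕ} (hν : 1 ≤ ν) {a : K} (ha : a ≠ 0) {P : MvPolynomial (Fin 3) κ}
    {R : MvPolynomial (Fin 3) K} (hR : ∀ m ∈ R.support, m 0 = 0 ∧ m 1 + m 2 = d)
    (h : MvPolynomial.map (algebraMap κ K) P = C a * (X 0 + R) ^ ν) :
    ∃ R₀ : Polynomial κ, R = MvPolynomial.map (algebraMap κ K)
      (∑ i ∈ Finset.range (d + 1), monomial (Finsupp.single 1 i + Finsupp.single 2 (d - i)) (R₀.coeff i)) := by
  set η : Polynomial K := MvPolynomial.aeval (![0, Polynomial.X, 1] : Fin 3 → Polynomial K) R with hη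
  set Θ : Polynomial (Polynomial κ) :=
    MvPolynomial.aeval (![Polynomial.X, Polynomial.C Polynomial.X, 1] : Fin 3 → Polynomial (Polynomial κ)) P with hΘ
  -- the identity under `θ`
  have h1 := congrArg
    (MvPolynomial.aeval (![Polynomial.X, Polynomial.C Polynomial.X, 1] : Fin 3 → Polynomial (Polynomial K))) h
  rw [aeval_theta_map, map_mul, map_pow, map_add, MvPolynomial.aeval_C, MvPolynomial.aeval_X,
    aeval_theta_eq_C_of_face (fun m hm => (hR m hm).1)] at h1
  have halg : algebraMap K (Polynomial (Polynomial K)) a = Polynomial.C (Polynomial.C a) := by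
    simp [Polynomial.algebraMap_apply]
  -- the binomial row
  have hrow : ∀ j ≤ ν, (Θ.coeff j).map (algebraMap κ K) =
      Polynomial.C a * ((ν.choose j : ℕ) : Polynomial K) * η ^ (ν - j) := by
    intro j _
    have h2 := congrArg (fun q : Polynomial (Polynomial K) => q.coeff j) h1
    simp only [Polynomial.coeff_map, Polynomial.coe_mapRingHom, Matrix.cons_val_zero] at h2
    rw [← hΘ] at h2
    rw [h2, halg, Polynomial.coeff_C_mul, Polynomial.coeff_X_add_C_pow]
    ring
  obtain ⟨R₀, hR₀⟩ :=
    FormallySmoothField.exists_map_eq_of_binomial_face_polynomial κ K hν (fun j => Θ.coeff j) ha hrow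
  refine ⟨R₀, ?_⟩
  conv_lhs => rw [eq_sum_monomial_of_face hR]
  rw [map_sum]
  refine Finset.sum_congr rfl fun i _ => ?_
  rw [map_monomial, ← hη, ← hR₀, Polynomial.coeff_map]

end JFlatEssSmooth

end Summit.ResolutionOfSingularities.ResolutionOfSingularities.Theorems

end
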